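import Summits.CriticalPhenomena.SAWScalingLimit.Theses.SAWDefectDecoherence

/-!
# Skeleton line `pick-half-plane` for crux `BoundaryClosureR` (stmt-CriticalPhenomena-14004)

Route `SAWDefectDecoherence`, crux r4
`BoundaryClosureR := DefectDecoherence → MassRatio → HexObservableLimitR` — the boundary
Riemann–Hilbert half of Duminil-Copin–Smirnov's Conjecture 2, GIVEN the route's two exponent
cruxes, over the repaired target `HexObservableLimitR` (root `a` and normaliser `b` pinned
conformally: flat horizontal piece + exact half-lattice `{v | m i δ ≤ v.1 1}` inside `ball (pt i) ρ`).

## The line (idea `pick-half-plane`, ideator 2; triage r1: 3 × pass)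

LEVER.  Let `H_δ` be the developing map (`dH = F dz` on the triangular sites; exists exactly by
DCS Lemma 1 + the discrete Poincaré lemma, `DevelopingMapExact` (E1)) and normalise by the COMPLEX
value at the normaliser: `h_δ := δ (H_δ - H_δ(s_b)) / F_δ(b_δ)`.  Every self-avoiding walk from one
floor dangling edge to another has winding `≡ π (mod 2π)`, so the card's functional
`u_δ = Im(conj κ · (H_δ - H_δ(b)))` is `(ℓ Z_δ(b_δ)/δ) · Re h_δ`:  CLAIM D reads

  `Re h_δ ≥ -o(1)` on the sites — the normalised developing map takes values in the closed RIGHT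
  half-plane, and maps the flat gate through `b` INTO THE IMAGINARY AXIS (increments
  `-(iℓδ/2) Z_δ(e)/Z_δ(b_δ)`, exact: (E2)+(E3)).

So every subsequential limit composed with a uniformiser is a Pick (Nevanlinna–Herglotz) function,
and positivity — unlike boundary values — passes to weak limits for free.  It buys: compactness by
HARNACK for nonnegative almost-harmonic functions (almost-harmonicity = the route's two exponent
cruxes through `DecoherenceSynthesis`: `‖∂̄h_δ‖_{L¹(K)} ≲ δ^{θ-3/4} → 0`), the ROOT ORDER `5/4` by
Herglotz growth + the exact straight arms at the root (E4) (no apex angle, no univalence, no Royster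
obstruction), REFLECTION at the flat gate as a corollary (`Re h = 0` there), and non-degeneracy from
positive arrival masses on the gate.  Identification of the limit is the sibling line
`two-root-quotient` (its stubs 1, 3–7), which this line feeds: `IsPickCupLimit` below is its
`IsCupLimit` export WITHOUT zero-freeness (zero-freeness = `NonVanishing`, where the Pick lever and
the cup lever meet, rides inside `stub_identification`).

SCOPE (triage r1-1/2/3 "convex only"): resolved by typing Claim D as LOWER BOUNDS —
`HalfPlaneBounds` (i): `Re h_δ ≥ -M_K` on the sites over every compact `K` of
`Ω ∪ (flat pieces) ∖ {root}`; (ii): the wedge form `Re(conj ω · h_δ) ≥ -M` near the root — both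
continuum-true for EVERY Dobrushin carrier (trivial on compacts of `Ω`; Koebe distortion up to the
flat pieces; the local `(z-x)^{-1/4}` wedge at the root), both exactly what Harnack-up-to-o(1)
consumes, and both sharpening to `M → 0` (Claim D proper, ≈ 10⁴ enumerated triples, 0 violations)
on convex carriers.  No carrier restriction enters the composition.

STUBS (7): `stub_developingMapExact` (exact, provable now) · `stub_halfPlaneBounds` (LOAD-BEARING
conjecture) · `stub_gateMassLaws` (positive-mass) · `stub_localL1Bound` (shared necessary input for
C⁰ test functions) · `stub_pickCompactness` (Harnack engine) · `stub_herglotzRegularity` (root order,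
reflection, boundary values) · `stub_identification` (import of `two-root-quotient`'s identification
half).  `closing` (subsequence principle) and `BoundaryClosureR_of` are sorry-free.

## Disproof / negatives used (Cruxes/BoundaryClosureR/Disproof.lean, cycle 1, read in full)
* (F0) `not_crux_iff`: the line is a PROOF device for `HexObservableLimitR` given DD, MR; (F3) no
  `_false_without_` exists on the crux side — nothing to honour there; DD and MR are consumed at
  `stub_pickCompactness` / `stub_herglotzRegularity` (almost-harmonicity on compacts and up to the
  flat pieces).
* (F2) `target_false_without_normaliserPin` is honoured at `stub_halfPlaneBounds` (i) /
  `stub_gateMassLaws` (a) / (E3): the gate is the EXACT zigzag row through `b_δ` (one class, one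
  winding) — for the dead-end-corridor-at-`b` family the gate structure is untouched while `F(b_δ)`
  is rescaled, so `Re h_δ ≥ -M` in `h`-units FAILS there, as the theorem demands of any proof.
  `target_false_without_rootPin` is honoured at (E4) / `HalfPlaneBounds` (ii) / `GateMassLaws` (b):
  the two straight arms and the arm divergence need the one-class flat row THROUGH the root.
* Landed negatives `BoundaryClosureR.Negative.{RootPin,NormaliserPin,EndCorridor,PeelEnd,ShiftedHalfDisc}`
  and `SAWDefectDecoherenceHexObservableLimit_refuted`: no stub is an instance — every statement
  pins every root and the normaliser (`PinnedFlatRoot`, `AdmissibleFamily`), and the corridor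
  families violate exactly those pins.  `ledger negatives` (9): 0772 (all-δ) — everything eventual;
  8312/10603 (one constant over disconnected supports) — constants here are per compact and per
  pinned point; nothing restated.
* (F5) stub audit of `two-root-quotient`: this line plugs into its `Identification` with the same
  vocabulary (`AdmissibleFamily`, `PinnedFlatRoot`, `IsWeakLimit` verbatim) and replaces its
  `stub_cupLimits` import by stubs 2–6 here.
-/

noncomputable section

open scoped BigOperators ComplexConjugate Topology
open Filter Set MeasureTheory
open Literature.Probability.LatticeModels Literature.Probability.RandomPlanarGeometry
open Literature.Probability.RandomPlanarGeometry.SAW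
open Summit.CriticalPhenomena.SAWScalingLimit.Theses.SAWDefectDecoherence

namespace Summit.CriticalPhenomena.SAWScalingLimit.Cruxes.BoundaryClosureR.PickHalfPlane

/-! ### 1. Vocabulary shared with the sibling line `two-root-quotient` (verbatim copies) -/

/-- The normalised functional `N^{e}_δ(ψ) := δ² Σ_{z ∈ Ω_δ} ψ(δ·mid z) F^{e δ}(z) / F^{e δ}(b δ)`
(root family `e`, normalisation family `b`, spin `5/8`, fugacity `x_c`). -/
def NF (Λ : ℝ → Finset HexVertex) (e b : ℝ → Sym2 HexVertex) (δ : ℝ) (ψ : ℂ → ℂ) : ℂ :=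
  (δ : ℂ) ^ 2 * (∑ᶠ z ∈ hexDomainMidEdges (Λ δ),
      ψ ((δ : ℂ) * hexMidpoint z) * hexParafermionicObservable (Λ δ) (e δ) hexCriticalFugacity (5 / 8) z) /
    hexParafermionicObservable (Λ δ) (e δ) hexCriticalFugacity (5 / 8) (b δ)

/-- Bulk test functions of the target: continuous, compactly supported inside the domain. -/
def IsTest (D : DobrushinDomain) (ψ : ℂ → ℂ) : Prop :=
  Continuous ψ ∧ HasCompactSupport ψ ∧ tsupport ψ ⊆ D.carrier

/-- The root-free part of the target's hypotheses: flat piece and exact half-lattice around the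
normalisation point `D.pt 1`, eventual admissibility of `Λ δ`, exhaustion of compacts, `b δ → pt 1`.
(Verbatim `TwoRootQuotient.AdmissibleFamily`.) -/
def AdmissibleFamily (D : DobrushinDomain) (ρ : ℝ) (Λ : ℝ → Finset HexVertex) (m : ℝ → ℤ)
    (b : ℝ → Sym2 HexVertex) : Prop :=
  0 < ρ ∧
  D.carrier ∩ Metric.ball (D.pt 1) ρ = {z : ℂ | (D.pt 1).im < z.im} ∩ Metric.ball (D.pt 1) ρ ∧
  (∀ᶠ δ : ℝ in 𝓝[>] 0, hexDomainSimplyConnected (Λ δ) ∧ b δ ∈ hexDomainBoundary (Λ δ) ∧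
      (hexGraph.induce ((Λ δ : Finset HexVertex) : Set HexVertex)).Preconnected ∧
      (∀ v ∈ Λ δ, (δ : ℂ) * hexCenter v ∈ D.carrier) ∧
      (∀ v : HexVertex, (δ : ℂ) * hexCenter v ∈ Metric.ball (D.pt 1) ρ → (v ∈ Λ δ ↔ m δ ≤ v.1 1))) ∧
  (∀ K : Set ℂ, IsCompact K → K ⊆ D.carrier →
      ∀ᶠ δ : ℝ in 𝓝[>] 0, ∀ v : HexVertex, (δ : ℂ) * hexCenter v ∈ K → v ∈ Λ δ) ∧
  Tendsto (fun δ : ℝ => (δ : ℂ) * hexMidpoint (b δ)) (𝓝[>] 0) (𝓝 (D.pt 1))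

/-- A root family `e` PINNED on a flat piece at `x ∈ ∂D`: inside `ball x r` the domain is the open
half-plane above `x` and `Λ δ` is exactly the half-lattice `{v | mr δ ≤ v.1 1}`; the roots are
boundary mid-edges with `δ·mid(e δ) → x`, and walks to the normaliser exist.
(Verbatim `TwoRootQuotient.PinnedFlatRoot`.) -/
def PinnedFlatRoot (D : DobrushinDomain) (Λ : ℝ → Finset HexVertex) (b : ℝ → Sym2 HexVertex)
    (x : ℂ) (e : ℝ → Sym2 HexVertex) (r : ℝ) (mr : ℝ → ℤ) : Prop :=
  0 < r ∧
  D.carrier ∩ Metric.ball x r = {z : ℂ | x.im < z.im} ∩ Metric.ball x r ∧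
  (∀ᶠ δ : ℝ in 𝓝[>] 0, e δ ∈ hexDomainBoundary (Λ δ) ∧ Nonempty (HexMidEdgeSAW (Λ δ) (e δ) (b δ)) ∧
      (∀ v : HexVertex, (δ : ℂ) * hexCenter v ∈ Metric.ball x r → (v ∈ Λ δ ↔ mr δ ≤ v.1 1))) ∧
  Tendsto (fun δ : ℝ => (δ : ℂ) * hexMidpoint (e δ)) (𝓝[>] 0) (𝓝 x)

/-- `g` is the weak limit of the normalised functionals of root family `e` along the mesh sequence
`ns`: `N^{e}_{ns n}(ψ) → ∫ ψ g` for every bulk test function. (Verbatim `TwoRootQuotient.IsWeakLimit`.) -/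
def IsWeakLimit (D : DobrushinDomain) (Λ : ℝ → Finset HexVertex) (e b : ℝ → Sym2 HexVertex)
    (ns : ℕ → ℝ) (g : ℂ → ℂ) : Prop :=
  ∀ ψ : ℂ → ℂ, IsTest D ψ → Tendsto (fun n => NF Λ e b (ns n) ψ) atTop (𝓝 (∫ z, ψ z * g z))

/-- The flat boundary points seen by a root pinned at `x` (radius `r`): the normaliser's flat piece
(the GATE) `{im = im (pt 1)} ∩ ball (pt 1) ρ` and the root's own flat piece `{im = im x} ∩ ball x r`.
(Verbatim `TwoRootQuotient.flatPoints`.) -/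
def flatPoints (D : DobrushinDomain) (ρ : ℝ) (x : ℂ) (r : ℝ) : Set ℂ :=
  ({z : ℂ | z.im = (D.pt 1).im} ∩ Metric.ball (D.pt 1) ρ) ∪ ({z : ℂ | z.im = x.im} ∩ Metric.ball x r)

/-! ### 2. Vocabulary of this line: the developing map, flat floors, Pick data -/

/-- `H : Site 2 → ℂ` is a POTENTIAL (developing map) of `F dz` for the domain `Λ` rooted at `a`:
along every triangular-lattice edge `s → t` dual to a hexagonal edge `{v, w}` (`v ∈ Λ`) and oriented
with the centre of `v` on its LEFT, `H t - H s = (mid{v,w} - c_v) · F_{x_c,5/8}({v,w})`.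
(Verbatim the body of the pool item `SAWDevelopingMap.PotentialExists`, stmt-8299.) -/
def IsPotential (Λ : Finset HexVertex) (a : Sym2 HexVertex) (H : Site 2 → ℂ) : Prop :=
  ∀ v ∈ Λ, ∀ w : HexVertex, hexGraph.Adj v w → ∀ s t : Site 2,
    s ∈ hexFaceVertices v → t ∈ hexFaceVertices v → s ∈ hexFaceVertices w → t ∈ hexFaceVertices w →
    s ≠ t → 0 < ((starRingEnd ℂ) (triEmbed t - triEmbed s) * (hexCenter v - triEmbed s)).im →
    H t - H s = (hexMidpoint s(v, w) - hexCenter v) *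
      hexParafermionicObservable Λ a hexCriticalFugacity (5 / 8) s(v, w)

/-- The up-face of the cell `(k, m)` (row `m` = second lattice coordinate). -/
def upFace (k m : ℤ) : HexVertex := (![k, m], 0)

/-- The down-face hanging BELOW the up-face of the cell `(k, m)` (it is `(![k, m-1], 1)`; the two
share the horizontal 𝕋-edge `{(k,m), (k+1,m)}` and their centres differ by the vertical `iℓ`). -/
def belowFace (k m : ℤ) : HexVertex := (![k, m - 1], 1)

/-- The vertical DANGLING edge under the cell `(k, m)`, written `s(outside, inside)` like the roots
`s(u, w)`, `u ∉ Λ ∋ w`, of the route file; its midpoint lies ON the floor line `im z = m √3/2`. -/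
def floorEdge (k m : ℤ) : Sym2 HexVertex := s(belowFace k m, upFace k m)

/-- Row `m` of `Λ` is an exact FLAT FLOOR over the columns `k₁ ≤ k ≤ k₂`: the up-faces are in `Λ`,
the faces below them are not (so every `floorEdge k m` is a boundary mid-edge), and the down-faces
of row `m` between consecutive up-faces are in `Λ` (no notch). Inside the pinned balls of the target
frame (`v ∈ Λ δ ↔ m ≤ v.1 1`) every floor segment is of this form. -/
def IsFlatFloor (Λ : Finset HexVertex) (m k₁ k₂ : ℤ) : Prop :=
  ∀ k : ℤ, k₁ ≤ k → k ≤ k₂ →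
    upFace k m ∈ Λ ∧ belowFace k m ∉ Λ ∧ (k < k₂ → ((![k, m], 1) : HexVertex) ∈ Λ)

/-- **Interior Pick limit** — what the Harnack engine (`stub_pickCompactness`) exports about a
subsequential limit density `g` of a root pinned at `x` (normaliser at `pt 1`): `g` is holomorphic
and not identically zero; it has a holomorphic primitive up to a universal nonzero factor
(`h' = α g`; expected `α = -i/12` from `dH = -(i/(2√3)) F dz` and the mid-edge density `2√3`), and
`h` — the limit of the normalised developing maps `h_δ = δ(H_δ - H_δ(s_b))/F_δ(b_δ)` — carries the
one-sided PICK DATA: `Re h` bounded below up to the flat pieces away from the root (vacuous on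
compacts of `Ω`, not at the flat boundary), and the WEDGE at the root: `Re(conj ω · h)` bounded below
on the half-disc of radius `r/2` for a unimodular `ω` (`= -e^{i(5/8)W_b}`, one of 8 classes). -/
def IsInteriorPickLimit (D : DobrushinDomain) (ρ : ℝ) (x : ℂ) (r : ℝ) (g : ℂ → ℂ) : Prop :=
  DifferentiableOn ℂ g D.carrier ∧ (∃ z ∈ D.carrier, g z ≠ 0) ∧
  ∃ (h : ℂ → ℂ) (α ω : ℂ), α ≠ 0 ∧ ‖ω‖ = 1 ∧ DifferentiableOn ℂ h D.carrier ∧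
    (∀ z ∈ D.carrier, deriv h z = α * g z) ∧
    (∀ K : Set ℂ, IsCompact K → K ⊆ D.carrier ∪ flatPoints D ρ x r → x ∉ K →
      ∃ M : ℝ, ∀ z ∈ K ∩ D.carrier, -M ≤ (h z).re) ∧
    (∃ M : ℝ, ∀ z ∈ D.carrier ∩ Metric.ball x (r / 2), -M ≤ ((starRingEnd ℂ) ω * h z).re)

/-- **Pick–cup limit** — the export contract of this line towards identification: the sibling
line's `TwoRootQuotient.IsCupLimit` WITHOUT zero-freeness (clauses 1, 3, 4 verbatim): holomorphic on
the domain, blow-up of exact order `5/4` at its own root with a nonzero coefficient, and nonzero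
boundary values at every other flat boundary point (gate and root piece). -/
def IsPickCupLimit (D : DobrushinDomain) (ρ : ℝ) (x : ℂ) (r : ℝ) (g : ℂ → ℂ) : Prop :=
  DifferentiableOn ℂ g D.carrier ∧
  (∃ κ : ℂ, κ ≠ 0 ∧ Tendsto (fun z => g z * (z - x) ^ ((5 : ℂ) / 4)) (𝓝[D.carrier] x) (𝓝 κ)) ∧
  (∀ y ∈ flatPoints D ρ x r, y ≠ x → ∃ w : ℂ, w ≠ 0 ∧ Tendsto g (𝓝[D.carrier] y) (𝓝 w))

/-! ### 3. The statements of the line -/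

/-- STUB 1 statement — **the exact structure of the developing map** (all four clauses are finite
lattice identities, provable now):
(E1) POTENTIAL: for `Λ` simply connected and a boundary root, a potential `H` of `F dz` exists
  (closedness on each triangle = DCS Lemma 1, `DuminilCopinSmirnov2012_lemma1_holds`, proved in the
  tree; exactness = discrete Poincaré lemma on the union of the closed triangles of `Λ`, whose
  complement is connected) — verbatim pool item `PotentialExists` (stmt-8299);
(E2) BOUNDARY PHASE LAW (the card's `BoundarySineLaw` in product form, root edge EXCLUDED as the
  triage demanded): for a boundary mid-edge `e = {u', w'} ≠ a` and any walk `γ : a → e`,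
  `(mid e - c_{w'}) · F_{5/8}(e) = ((c_w - c_u)/2) · e^{i(3/8)W(γ)} · Z(e)` — final direction
  `= e^{iW}·`initial direction (turning angles telescope walk by walk) and `F_{5/8}(e) = Z(e)
  e^{-i(5/8)W_e}` (winding rigidity, item 8515); taking `Im(conj κ · _)` gives the sine law;
(E3) STRAIGHT GATE: two floor edges of one flat floor not containing the root receive the same
  winding from the root (`W = Δτ_ccw - π`, the flat floor turns by `0`);
(E4) ROOT ARMS: from a floor root, floor edges of the same flat floor to the EAST receive winding
  `-π`, to the WEST `+π` (Jordan curve + simple connectivity: the loop closed along the floor is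
  clockwise / counter-clockwise). -/
def DevelopingMapExact : Prop :=
  (∀ (Λ : Finset HexVertex), hexDomainSimplyConnected Λ → ∀ a ∈ hexDomainBoundary Λ,
      ∃ H : Site 2 → ℂ, IsPotential Λ a H) ∧
  (∀ (Λ : Finset HexVertex), hexDomainSimplyConnected Λ →
    ∀ (u w : HexVertex), hexGraph.Adj u w → u ∉ Λ → w ∈ Λ →
    ∀ (u' w' : HexVertex), hexGraph.Adj u' w' → u' ∉ Λ → w' ∈ Λ → s(u', w') ≠ s(u, w) →
    ∀ γ : HexMidEdgeSAW Λ s(u, w) s(u', w'),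
      (hexMidpoint s(u', w') - hexCenter w') *
          hexParafermionicObservable Λ s(u, w) hexCriticalFugacity (5 / 8) s(u', w') =
        (hexCenter w - hexCenter u) / 2 * Complex.exp (Complex.I * (3 / 8 : ℂ) * (γ.winding : ℂ)) *
          (‖hexParafermionicObservable Λ s(u, w) hexCriticalFugacity 0 s(u', w')‖ : ℂ)) ∧
  (∀ (Λ : Finset HexVertex), hexDomainSimplyConnected Λ →
    ∀ (u w : HexVertex), hexGraph.Adj u w → u ∉ Λ → w ∈ Λ →
    ∀ (m k₁ k₂ : ℤ), IsFlatFloor Λ m k₁ k₂ → (∀ k : ℤ, k₁ ≤ k → k ≤ k₂ → floorEdge k m ≠ s(u, w)) →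
    ∀ (kb ke : ℤ), k₁ ≤ kb → kb ≤ k₂ → k₁ ≤ ke → ke ≤ k₂ →
    ∀ (γb : HexMidEdgeSAW Λ s(u, w) (floorEdge kb m)) (γe : HexMidEdgeSAW Λ s(u, w) (floorEdge ke m)),
      γe.winding = γb.winding) ∧
  (∀ (Λ : Finset HexVertex), hexDomainSimplyConnected Λ →
    ∀ (m k₁ k₂ ka : ℤ), IsFlatFloor Λ m k₁ k₂ → k₁ ≤ ka → ka ≤ k₂ →
    ∀ (ke : ℤ), k₁ ≤ ke → ke ≤ k₂ → ∀ γ : HexMidEdgeSAW Λ (floorEdge ka m) (floorEdge ke m),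
      (ka < ke → γ.winding = -Real.pi) ∧ (ke < ka → γ.winding = Real.pi))

/-- STUB 2 statement — **CLAIM D as one-sided a-priori bounds (LOAD-BEARING)**.  For every
admissible family, every pinned flat root `x ≠ pt 1` and the normalised developing map
`h_δ(s) := δ (H(s) - H(s_b)) / F_δ(b_δ)` (`s_b` either site of the floor edge `b_δ`; any potential
`H`):
(i) BULK/GATE FORM: for every compact `K ⊆ Ω ∪ (flat pieces at pt 1 and at x)` avoiding the root
  there is `M` with `Re h_δ(s) ≥ -M` at every site `s` over `K`, eventually in `δ`;
(ii) ROOT WEDGE FORM: there is `M` such that eventually, for some unimodular `ω` (the class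
  `-e^{i(5/8)W_b}` of the mesh), `Re(conj ω · h_δ(s)) ≥ -M` at every site over `closedBall x (r/2)`.
Continuum shadow: (i) is Koebe distortion (`h̃ = c∫ψ'^{3/8}` is continuous on `ℍ̄`), (ii) is the
wedge `B(z-x)^{-1/4}` of half-opening `π/8` — true for EVERY Dobrushin carrier; on CONVEX carriers
both hold with `M → 0` (Claim D proper: `Re h_δ ≥ -ε`, census ≈ 10⁴ (domain, root, normaliser)
triples by three independent enumerators, 0 violations).  One-sided, `Φ`-free, invisible to the
vertex relations (a kernel element of the half-CR barrier flips the sign inside). -/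
def HalfPlaneBounds : Prop :=
  ∀ (D : DobrushinDomain) (ρ : ℝ) (Λ : ℝ → Finset HexVertex) (m : ℝ → ℤ) (b : ℝ → Sym2 HexVertex),
    AdmissibleFamily D ρ Λ m b →
  ∀ (x : ℂ) (e : ℝ → Sym2 HexVertex) (r : ℝ) (mr : ℝ → ℤ), PinnedFlatRoot D Λ b x e r mr → x ≠ D.pt 1 →
  let F : ℝ → Sym2 HexVertex → ℂ := fun δ z =>
    hexParafermionicObservable (Λ δ) (e δ) hexCriticalFugacity (5 / 8) z
  (∀ K : Set ℂ, IsCompact K → K ⊆ D.carrier ∪ flatPoints D ρ x r → x ∉ K →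
    ∃ M : ℝ, ∀ᶠ δ : ℝ in 𝓝[>] 0, ∀ H : Site 2 → ℂ, IsPotential (Λ δ) (e δ) H →
      ∀ (ub wb : HexVertex), b δ = s(ub, wb) →
      ∀ sb : Site 2, sb ∈ hexFaceVertices ub → sb ∈ hexFaceVertices wb →
      ∀ v ∈ Λ δ, ∀ s ∈ hexFaceVertices v, (δ : ℂ) * triEmbed s ∈ K →
        -M ≤ ((δ : ℂ) * (H s - H sb) / F δ (b δ)).re) ∧
  (∃ M : ℝ, ∀ᶠ δ : ℝ in 𝓝[>] 0, ∃ ω : ℂ, ‖ω‖ = 1 ∧ ∀ H : Site 2 → ℂ, IsPotential (Λ δ) (e δ) H →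
      ∀ (ub wb : HexVertex), b δ = s(ub, wb) →
      ∀ sb : Site 2, sb ∈ hexFaceVertices ub → sb ∈ hexFaceVertices wb →
      ∀ v ∈ Λ δ, ∀ s ∈ hexFaceVertices v, (δ : ℂ) * triEmbed s ∈ Metric.closedBall x (r / 2) →
        -M ≤ ((starRingEnd ℂ) ω * ((δ : ℂ) * (H s - H sb) / F δ (b δ))).re)

/-- STUB 3 statement — **positive-mass laws for boundary arrival masses** (`Z = F_{x_c,0}` from the
pinned root, lattice statements about POSITIVE, domain-monotone quantities; no cancellation):
(a) GATE COMPARABILITY (two-sided, local): on every sub-ball `ball y ρ'` of the gate at distance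
  `≥ 2ρ'` from the root, the total arrival mass is comparable to `Z(b_δ)/δ`:
  `C⁻¹ Z(b_δ) ≤ δ Σ_{e' ∈ ∂Λ_δ, δ·mid e' ∈ ball y ρ'} Z(e') ≤ C Z(b_δ)` eventually — the anchor of
  the Harnack chain (upper) and the non-degeneracy of the normal derivative of `Re h` on the gate
  (lower); conformally the density is `(Φ_x'(y)/Φ_x'(b))^{5/8} dy`, continuous and positive;
(b) ROOT-ARM DIVERGENCE (ratio form, no absolute exponent): the arrival mass on the root's own flat
  piece to the east at macroscopic distance `∈ (η, r/2)`, in units of `Z(b_δ)/δ`, exceeds any `A`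
  for `η` small — along the exact straight arm this is `Re(conj ω · h_δ) → +∞` at the root, i.e.
  the singularity survives in the limit (predicted `δ Σ_{η<kδ<r/2} k^{-5/4} / δ^{5/4} ≍ η^{-1/4}`). -/
def GateMassLaws : Prop :=
  ∀ (D : DobrushinDomain) (ρ : ℝ) (Λ : ℝ → Finset HexVertex) (m : ℝ → ℤ) (b : ℝ → Sym2 HexVertex),
    AdmissibleFamily D ρ Λ m b →
  ∀ (x : ℂ) (e : ℝ → Sym2 HexVertex) (r : ℝ) (mr : ℝ → ℤ), PinnedFlatRoot D Λ b x e r mr → x ≠ D.pt 1 →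
  let Z : ℝ → Sym2 HexVertex → ℝ := fun δ z =>
    ‖hexParafermionicObservable (Λ δ) (e δ) hexCriticalFugacity 0 z‖
  (∀ (y : ℂ) (ρ' : ℝ), y.im = (D.pt 1).im → 0 < ρ' →
      Metric.closedBall y ρ' ⊆ Metric.ball (D.pt 1) ρ → x ∉ Metric.closedBall y (2 * ρ') →
    ∃ C : ℝ, 0 < C ∧ ∀ᶠ δ : ℝ in 𝓝[>] 0,
      C⁻¹ * Z δ (b δ) ≤ δ * ∑ᶠ e' ∈ {e' : Sym2 HexVertex | e' ∈ hexDomainBoundary (Λ δ) ∧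
          (δ : ℂ) * hexMidpoint e' ∈ Metric.ball y ρ'}, Z δ e' ∧
      δ * ∑ᶠ e' ∈ {e' : Sym2 HexVertex | e' ∈ hexDomainBoundary (Λ δ) ∧
          (δ : ℂ) * hexMidpoint e' ∈ Metric.ball y ρ'}, Z δ e' ≤ C * Z δ (b δ)) ∧
  (∀ A : ℝ, ∃ η : ℝ, 0 < η ∧ η < r / 2 ∧ ∀ᶠ δ : ℝ in 𝓝[>] 0,
      A * Z δ (b δ) ≤ δ * ∑ᶠ e' ∈ {e' : Sym2 HexVertex | e' ∈ hexDomainBoundary (Λ δ) ∧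
          (δ : ℂ) * hexMidpoint e' ∈ Metric.ball x (r / 2) ∧
          x.re + η < ((δ : ℂ) * hexMidpoint e').re}, Z δ e')

/-- STUB 4 statement — **the local `L¹` law** (the residual input shared by EVERY line of this crux,
Banach–Steinhaus-necessary for continuous test functions; triage r1-3 §3 "state the C¹/C² → C⁰ step
as its own stub"): on compacts of `Ω` the `b`-normalised observable has bounded `L¹` mass,
`δ² Σ_{δ·mid z ∈ K} |F_δ(z)| ≤ C_K |F_δ(b_δ)|` eventually.  (The route's `MassRatio` gives only
`C δ^{-3/4}` for the MASSES `Z ≥ |F|`; the bound needs the `δ^{25/48}`-cancellation of the phases —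
the crux's failure mode #2, isolated; used here ONLY to pass from `C¹` to `C⁰` test functions.) -/
def LocalL1Bound : Prop :=
  ∀ (D : DobrushinDomain) (ρ : ℝ) (Λ : ℝ → Finset HexVertex) (m : ℝ → ℤ) (b : ℝ → Sym2 HexVertex),
    AdmissibleFamily D ρ Λ m b →
  ∀ (x : ℂ) (e : ℝ → Sym2 HexVertex) (r : ℝ) (mr : ℝ → ℤ), PinnedFlatRoot D Λ b x e r mr → x ≠ D.pt 1 →
  ∀ K : Set ℂ, IsCompact K → K ⊆ D.carrier → ∃ C : ℝ, ∀ᶠ δ : ℝ in 𝓝[>] 0,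
    δ ^ 2 * (∑ᶠ z ∈ {z : Sym2 HexVertex | z ∈ hexDomainMidEdges (Λ δ) ∧ (δ : ℂ) * hexMidpoint z ∈ K},
        ‖hexParafermionicObservable (Λ δ) (e δ) hexCriticalFugacity (5 / 8) z‖) ≤
      C * ‖hexParafermionicObservable (Λ δ) (e δ) hexCriticalFugacity (5 / 8) (b δ)‖

/-- STUB 5 conclusion — **interior Pick limits**: for every admissible family and every pinned flat
root other than the normalisation point, every mesh sequence has a subsequence along which the
normalised functionals converge weakly (continuous test functions) to an interior Pick limit. -/
def InteriorLimits : Prop :=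
  ∀ (D : DobrushinDomain) (ρ : ℝ) (Λ : ℝ → Finset HexVertex) (m : ℝ → ℤ) (b : ℝ → Sym2 HexVertex),
    AdmissibleFamily D ρ Λ m b →
  ∀ (x : ℂ) (e : ℝ → Sym2 HexVertex) (r : ℝ) (mr : ℝ → ℤ), PinnedFlatRoot D Λ b x e r mr → x ≠ D.pt 1 →
  ∀ ns : ℕ → ℝ, Tendsto ns atTop (𝓝[>] 0) →
    ∃ ms : ℕ → ℕ, StrictMono ms ∧ ∃ g : ℂ → ℂ,
      IsInteriorPickLimit D ρ x r g ∧ IsWeakLimit D Λ e b (ns ∘ ms) g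

/-- STUB 6 conclusion — **Pick–cup limits**: the same with the export contract the identification
consumes (order `5/4` at the root with nonzero coefficient, nonzero boundary values at the other
flat points).  This is `TwoRootQuotient.CupLimits` with `IsCupLimit` replaced by `IsPickCupLimit`
(zero-freeness dropped). -/
def PickCupLimits : Prop :=
  ∀ (D : DobrushinDomain) (ρ : ℝ) (Λ : ℝ → Finset HexVertex) (m : ℝ → ℤ) (b : ℝ → Sym2 HexVertex),
    AdmissibleFamily D ρ Λ m b →
  ∀ (x : ℂ) (e : ℝ → Sym2 HexVertex) (r : ℝ) (mr : ℝ → ℤ), PinnedFlatRoot D Λ b x e r mr → x ≠ D.pt 1 →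
  ∀ ns : ℕ → ℝ, Tendsto ns atTop (𝓝[>] 0) →
    ∃ ms : ℕ → ℕ, StrictMono ms ∧ ∃ g : ℂ → ℂ, IsPickCupLimit D ρ x r g ∧ IsWeakLimit D Λ e b (ns ∘ ms) g

/-- STUB 7 conclusion — **identification** of every subsequential Pick–cup limit of the TARGET's
root with ONE universal constant: `g = c · exp((5/8)(L - L_b))` on the domain.
(`TwoRootQuotient.Identification` with `IsCupLimit` replaced by `IsPickCupLimit`.) -/
def Identification : Prop :=
  ∃ c : ℂ, c ≠ 0 ∧
  ∀ (D : DobrushinDomain) (ρ : ℝ) (Λ : ℝ → Finset HexVertex) (m : ℝ → ℤ) (b : ℝ → Sym2 HexVertex),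
    AdmissibleFamily D ρ Λ m b →
  ∀ (a : ℝ → Sym2 HexVertex) (r₀ : ℝ) (m₀ : ℝ → ℤ), PinnedFlatRoot D Λ b (D.pt 0) a r₀ m₀ →
  ∀ (Φ : ConformalEquiv D.carrier UpperHalfPlane.upperHalfPlaneSet) (L : ℂ → ℂ) (Lb : ℂ),
    Tendsto (fun z => ‖Φ z‖) (𝓝[D.carrier] (D.pt 0)) atTop → Φ.HasBoundaryValue (D.pt 1) 0 →
    ContinuousOn L D.carrier → (∀ z ∈ D.carrier, Complex.exp (L z) = deriv Φ z) →
    Tendsto L (𝓝[D.carrier] (D.pt 1)) (𝓝 Lb) →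
  ∀ ns : ℕ → ℝ, Tendsto ns atTop (𝓝[>] 0) →
  ∀ g : ℂ → ℂ, IsPickCupLimit D ρ (D.pt 0) r₀ g → IsWeakLimit D Λ a b ns g →
    ∀ z ∈ D.carrier, g z = c * Complex.exp ((5 / 8 : ℂ) * (L z - Lb))

/-! ### 4. The registered stubs (the only `sorry`s of the file) -/

/-- STUB 1 (M–L; provable now): potential, boundary phase law, straight gate, root arms. -/
theorem stub_developingMapExact : DevelopingMapExact := by
  sorry

/-- STUB 2 (XL; LOAD-BEARING, the line's one conjecture about the model): Claim D as one-sided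
a-priori bounds for the normalised developing map.  Lattice mechanism open (candidates: a walk
involution pairing negative-sine arrivals with positive ones along interior dual paths; induction
over peelable faces with `observable_insert`; a discrete minimum principle / convex-hull property for
`H_δ`, which the census supports edge-wise). -/
theorem stub_halfPlaneBounds : HalfPlaneBounds := by
  sorry

/-- STUB 3 (L; open, positive-mass): gate comparability and root-arm divergence. -/
theorem stub_gateMassLaws : GateMassLaws := by
  sorry

/-- STUB 4 (L; open, shared with every line of the crux): the local `L¹` law. -/
theorem stub_localL1Bound : LocalL1Bound := by
  sorry

/-- STUB 5 (XL; the Harnack engine — the card's item 2): Claim D (i) + almost-harmonicity on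
compacts from `DefectDecoherence` + `MassRatio` (via the route's `DecoherenceSynthesis`:
`‖∂̄h_δ‖_{L¹(K)} ≲ d^{-θ} δ^{θ-3/4} → 0`) give Harnack up to an additive `o(1)` for the mollified
`Re h_δ + M`; the ANCHOR (two-sided bound at a point above `b`) is the exact gate (`Re h_δ = 0` on
the gate sites, (E2)+(E3)) + the gate flux identity + `GateMassLaws` (a); hence `sup_K |h_δ ∗ η_ε|`
bounded, `h_δ → h` in `L¹_loc` along subsequences (`LocalL1Bound` controls the sub-mollifier
oscillation and upgrades `C¹` to `C⁰` test functions), `g := α⁻¹ h'` holomorphic, lower bounds pass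
to the limit, and `g ≢ 0` from the lower gate bound.  No degree theory, no area formula, no
univalence. -/
theorem stub_pickCompactness :
    DevelopingMapExact → HalfPlaneBounds → GateMassLaws → LocalL1Bound →
      DefectDecoherence → MassRatio → InteriorLimits := by
  sorry

/-- STUB 6 (L–XL; the Herglotz half — the card's items 3–4): run the same engine up to the EXACT
flat pieces (boundary Harnack on the half-lattice) to get the boundary data of `h` in the limit —
`Re h → 0` on the gate with `c t ≤ Re h(y+it) ≤ C t` (`GateMassLaws` (a)), the two straight arms
`Im(conj(ω e^{±iπ/8}) h) = const` on the east/west rays at the root (E4) with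
`Re(conj ω · h) → +∞` (`GateMassLaws` (b)); then pure complex analysis: Schwarz reflection across
the gate (`g(y) ≠ 0` from the flux bounds) and across each arm, Herglotz growth for
`conj ω · h + iM` near the root (positive harmonic functions grow at most linearly in the
uniformising variable ⇒ the exponent of `h` at `x` is in `{-1/4, +1/4}` by the arm angle `π/4`, and
divergence excludes `+1/4`), whence `g (z-x)^{5/4} → κ ≠ 0`. -/
theorem stub_herglotzRegularity :
    DevelopingMapExact → HalfPlaneBounds → GateMassLaws → LocalL1Bound →
      DefectDecoherence → MassRatio → InteriorLimits → PickCupLimits := by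
  sorry

/-- STUB 7 (XL; IMPORT of the sibling line `two-root-quotient`, stubs 1, 3–7 — two-root arc
constancy, ratio continuity, root-ratio law, flat locality, flat trace, closing by reciprocity —
together with `NonVanishing` (zero-freeness of Pick–cup limits: where this lever meets the cup's
degree-one lever; alternatively the card's item 5, closing the two-root quotient
`S = (f_{a'}/f_a)(1 - Φ/t)^{5/4}` by boundary continuity)): identification with one universal
constant. -/
theorem stub_identification : PickCupLimits → Identification := by
  sorry

/-! ### Name-keyed aliases of the stub statements (hypotheses of the composition) -/
namespace Registered

/-- Alias keyed by the registered stub name. -/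
abbrev stub_developingMapExact : Prop := DevelopingMapExact
/-- Alias keyed by the registered stub name. -/
abbrev stub_halfPlaneBounds : Prop := HalfPlaneBounds
/-- Alias keyed by the registered stub name. -/
abbrev stub_gateMassLaws : Prop := GateMassLaws
/-- Alias keyed by the registered stub name. -/
abbrev stub_localL1Bound : Prop := LocalL1Bound
/-- Alias keyed by the registered stub name. -/
abbrev stub_pickCompactness : Prop :=
  DevelopingMapExact → HalfPlaneBounds → GateMassLaws → LocalL1Bound →
    DefectDecoherence → MassRatio → InteriorLimits
/-- Alias keyed by the registered stub name. -/
abbrev stub_herglotzRegularity : Prop :=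
  DevelopingMapExact → HalfPlaneBounds → GateMassLaws → LocalL1Bound →
    DefectDecoherence → MassRatio → InteriorLimits → PickCupLimits
/-- Alias keyed by the registered stub name. -/
abbrev stub_identification : Prop := PickCupLimits → Identification

end Registered

/-! ### 5. The sorry-free part: subsequence principle and the composition -/

/-- **Closing step (no `sorry`)**: Pick–cup limits along subsequences of every mesh sequence
(`PickCupLimits`) and their identification with one universal constant (`Identification`) give the
pinned target, by `Filter.tendsto_of_subseq_tendsto` on the countably generated filter `𝓝[>] 0`.
(Port of `TwoRootQuotient.closing`.) -/
theorem closing (hC : PickCupLimits) (hI : Identification) : HexObservableLimitR := by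
  obtain ⟨c, hc, hId⟩ := hI
  refine ⟨c, hc, ?_⟩
  intro D ρ Λ m a b Φ L Lb ψ F hρ hflat hadm hexh ha hb hΦ hΦb hL hexpL hLb hψc hψK hψD
  -- repackage the hypotheses
  have hAF : AdmissibleFamily D ρ Λ (m 1) b := by
    refine ⟨hρ, hflat 1, ?_, hexh, hb⟩
    filter_upwards [hadm] with δ hδ
    exact ⟨hδ.1, hδ.2.2.1, hδ.2.2.2.2.1, hδ.2.2.2.2.2.1, hδ.2.2.2.2.2.2 1⟩
  have hPR : PinnedFlatRoot D Λ b (D.pt 0) a ρ (m 0) := by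
    refine ⟨hρ, hflat 0, ?_, ha⟩
    filter_upwards [hadm] with δ hδ
    exact ⟨hδ.2.1, hδ.2.2.2.1, hδ.2.2.2.2.2.2 0⟩
  have h01 : D.pt 0 ≠ D.pt 1 := fun h => absurd (D.pt_injective h) (by decide)
  have hψ : IsTest D ψ := ⟨hψc, hψK, hψD⟩
  -- the subsequence principle on the countably generated filter `𝓝[>] 0`
  refine Filter.tendsto_of_subseq_tendsto fun ns hns => ?_
  obtain ⟨ms, hms, g, hg, hw⟩ := hC D ρ Λ (m 1) b hAF (D.pt 0) a ρ (m 0) hPR h01 ns hns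
  have hns' : Tendsto (ns ∘ ms) atTop (𝓝[>] 0) := hns.comp hms.tendsto_atTop
  have hid : ∀ z ∈ D.carrier, g z = c * Complex.exp ((5 / 8 : ℂ) * (L z - Lb)) :=
    hId D ρ Λ (m 1) b hAF a ρ (m 0) hPR Φ L Lb hΦ hΦb hL hexpL hLb (ns ∘ ms) hns' g hg hw
  -- the limit density is `c · exp((5/8)(L - Lb))` on the domain and `ψ` vanishes off the domain
  have hint : ∫ z, ψ z * g z = c * ∫ z, ψ z * Complex.exp ((5 / 8 : ℂ) * (L z - Lb)) := by
    rw [← integral_const_mul]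
    refine integral_congr_ae (Filter.Eventually.of_forall fun z => ?_)
    by_cases hz : z ∈ D.carrier
    · simp only [hid z hz]; ring
    · have hψz : ψ z = 0 := image_eq_zero_of_notMem_tsupport fun h => hz (hψD h)
      simp only [hψz, zero_mul, mul_zero]
  have key := hw ψ hψ
  rw [hint] at key
  exact ⟨ms, key⟩

/-- **The composition (kernel-checked, no `sorry`)**: the seven stubs imply the crux
`BoundaryClosureR` BY NAME.  Given the antecedents `DefectDecoherence`, `MassRatio`: STUB 5 (fed by
STUBS 1–4) produces interior Pick limits; STUB 6 upgrades them to Pick–cup limits; STUB 7 identifies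
every subsequential limit of the target's root with the universal constant; `closing` concludes by
the subsequence principle. -/
theorem BoundaryClosureR_of (h1 : Registered.stub_developingMapExact)
    (h2 : Registered.stub_halfPlaneBounds) (h3 : Registered.stub_gateMassLaws)
    (h4 : Registered.stub_localL1Bound) (h5 : Registered.stub_pickCompactness)
    (h6 : Registered.stub_herglotzRegularity) (h7 : Registered.stub_identification) :
    Summit.CriticalPhenomena.SAWScalingLimit.Theses.SAWDefectDecoherence.BoundaryClosureR :=
  fun hDD hMR =>
    have hP : PickCupLimits := h6 h1 h2 h3 h4 hDD hMR (h5 h1 h2 h3 h4 hDD hMR)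
    closing hP (h7 hP)

/-- Wiring check: the registered stubs feed `BoundaryClosureR_of` as stated. -/
example : Summit.CriticalPhenomena.SAWScalingLimit.Theses.SAWDefectDecoherence.BoundaryClosureR :=
  BoundaryClosureR_of stub_developingMapExact stub_halfPlaneBounds stub_gateMassLaws
    stub_localL1Bound stub_pickCompactness stub_herglotzRegularity stub_identification

end Summit.CriticalPhenomena.SAWScalingLimit.Cruxes.BoundaryClosureR.PickHalfPlane

end
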